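import Literature.NumberTheory.GaloisCohomology.Howard2004.InertLagrangianTransferProofs
import Literature.NumberTheory.GaloisCohomology.Howard2004.StubLocalizationTransferProofs
import HarnessLib

/-!
# Howard 2004, Prop. 1.5.9 at an inert Kolyvagin prime, ASSEMBLED: «`loc_q(Stub(n)) = 0 ⟹ loc_q(Stub(nq)) = 0`»
# from the local hypotheses (proofs file)

Topic `NumberTheory/GaloisCohomology/Howard2004`. THEOREMS ONLY: no definition, no named fact, no instance, no
notation, no `sorry`. Cell `pub/bsd-print-x9`, print leaf G87
`Literature.NumberTheory.GaloisCohomology.Howard2004.thm161_dvrKolyvaginBound` (Howard Thm. 1.6.1); seat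
`bsd-line-x9-p1-w4` g16, brick (H159-LOC).

SOURCE / WHY. B. Howard, *The Heegner point Kolyvagin system*, Compositio Math. **140** (2004) = arXiv:1202.6340,
Prop. 1.5.9 (arXiv Prop. 2.5.9, p. 10 L146 – p. 11 L13): «For `nℓ ∈ 𝓝`, `loc_ℓ(Stub(n)) = 0 ⟹ loc_ℓ(Stub(ℓn)) = 0`» —
the hypothesis `h159` of the induction of Lemma 1.6.4 (`StubLemmaInductionProofs`).  x9-p1-w3's
`StubLocalizationTransferProofs.smul_le_ker_of_smul_le_ker_of_transfer` proves it from the structure decompositions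
and the TRANSFER function `htransfer`; `InertLagrangianTransferProofs.forall_pow_smul_eq_zero_of_inert_local` (this
seat) proves `htransfer` at an inert Kolyvagin prime from the Galois inputs of Lemmas 1.5.6–1.5.8.  This file plugs the
latter into the former:
**`DualityDatum.smul_le_ker_of_smul_le_ker_of_inert_local`** — for Howard's structures `𝓕(n) = 𝓕.modify 𝒯 ∅ ∅ n`,
`𝓕(nq)`, `𝓕_q(n)`, `𝓕^q(n)` (`SelmerStructure.modify`) at an inert `q ∉ n` with `𝓕_q = H¹_ur`, `𝒯_q = H¹_tr`:
`ϖ^{λ(n)} • 𝓗(n) ≤ ker loc_q → ϖ^{λ(nq)} • 𝓗(nq) ≤ ker loc_q`, over the DVR `𝒪` of coefficients, given the two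
structure decompositions `𝓗(n) ≅ Q^ε × M₁²`, `𝓗(nq) ≅ Q^ε × M₂²`, the splitting `H¹(K_q, T) = H¹_ur ⊕ H¹_tr ≅ (𝒪/ϖ^k)² ⊕ (𝒪/ϖ^k)²`
(Prop. 1.1.9) and the local/READ hypotheses of the seven input files (all carried as binders).

NOT HERE: the discharge of those binders (x9-p1-w3's Prop 1.1.9 files give `IsCompl`/the linear equivalences/`hcyc`;
the READ data, the Poitou–Tate family, H.4 for `𝓕(n)` off `q` (`SelfOrthogonalOfIsotropicCountProofs.isSelfOrthogonal_of_eq_off`),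
the datum facts (φI)/(φΛ)/(δ) remain hypotheses); `thm161_dvrKolyvaginBound` is NOT proved; no summit statement is
proved; the Birch–Swinnerton-Dyer conjecture is not proved by any of this.
References: [Howard2004HeegnerKolyvagin] Prop. 1.5.9, Lemmas 1.5.6–1.5.8, Def. 1.2.2, §1.3 H.4; [MilneADT2006] I Cor. 2.3, Thm. 4.10.
-/

set_option autoImplicit false

noncomputable section

open CategoryTheory Function NumberField IsDedekindDomain Field
open scoped NumberField

namespace Literature.NumberTheory.GaloisCohomology.Howard2004

open Literature.NumberTheory.GaloisRepresentations
open Literature.NumberTheory.GaloisRepresentations.DiscreteGaloisModule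

variable {K : Type} [Field K] [NumberField K] {M : Type} [AddCommGroup M] [TopologicalSpace M]
  [DiscreteTopology M] {R : Type} [CommRing R] [Module R M] [TopologicalSpace R] [DiscreteTopology R]
  {p : ℕ} [Fact p.Prime] [Algebra ℤ_[p] R] {cd : ConjugationDatum K} {ρ : DiscreteGaloisModule K M}
  [Finite M] [Finite R] (D : DualityDatum p cd ρ R) {k : ℕ}
  (lam : R →+ ZMod (p ^ k))
  (hlam : ∀ (z : ℤ_[p]) (r : R), lam (algebraMap ℤ_[p] R z * r) = PadicInt.toZModPow k z * lam r)
  (exp : ZMod (p ^ k) →+ MuCarrier K (p ^ k))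
  (hexp : ∀ (g : absoluteGaloisGroup K) (x : ZMod (p ^ k)),
    exp (cyclotomicCharacterModPow K p k g * x) = mu K (p ^ k) g (exp x))

namespace DualityDatum

include hlam hexp in
open scoped Classical in
open Pointwise in
/-- **Howard 2004, Prop. 1.5.9 («`loc_q(Stub(n)) = 0 ⟹ loc_q(Stub(nq)) = 0`») at an inert Kolyvagin prime `q ∉ n`,
assembled from the local hypotheses.**  Setting of `StubLocalizationTransferProofs.smul_le_ker_of_smul_le_ker_of_transfer`
(structures `𝓕(n)`, `𝓕(nq)`, `𝓕_q(n)`, `𝓕^q(n)`; `𝒪`-submodules with those Selmer groups / local conditions as underlying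
groups; decompositions `θ₁`, `θ₂`) over the DVR `𝒪` of coefficients acting on `T` through the level ring `R`, plus the
hypotheses of `InertLagrangianTransferProofs.forall_pow_smul_eq_zero_of_inert_local` for `𝓡 = 𝓕^q(n)` relaxed at `q` and
`𝓕(n)` off `q`, with `𝓕_q = H¹_ur(K_q, T)` and `𝒯_q = H¹_tr(K_q, T)`.  Conclusion: `ϖ^{λ₁} • 𝓗(n) ≤ ker f → ϖ^{λ₂} • 𝓗(nq) ≤ ker f`
for any `𝒪`-linear `f` agreeing with `loc_q` — the input `h159` of `StubLemmaInductionProofs` at the prime `q`.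
[cite: Howard2004HeegnerKolyvagin, Prop. 1.5.9 (arXiv:1202.6340 Prop. 2.5.9, p. 10 L146 – p. 11 L13)] [cite: MilneADT2006, Ch. I Cor. 2.3 and Thm. 4.10] -/
theorem smul_le_ker_of_smul_le_ker_of_inert_local
    {𝒪 : Type} [CommRing 𝒪] [IsDomain 𝒪] [IsDiscreteValuationRing 𝒪] [Algebra 𝒪 R] [Module 𝒪 M]
    [IsScalarTower 𝒪 R M] {ϖ : 𝒪} (hϖ : Irreducible ϖ) (h2 : IsUnit (2 : 𝒪))
    (hsoc : ∀ a b : R, ϖ • a = 0 → ϖ • b = 0 → a ≠ 0 → ∃ c : 𝒪, b = c • a)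
    (hρ𝒪 : ρ.IsScalarLinear 𝒪) (hρ : ρ.IsScalarLinear R)
    (hn : ∀ m : M, (p ^ k) • m = 0) (hRk : ∀ x : R, (p ^ k) • x = 0) (hRp : IsPrimaryTorsion p R)
    (inv : LocalInvariants K (p ^ k)) (hPT : inv.SumLocalTermEqZero) (hSC : inv.SelmerComplement)
    (hperf : inv.IsPerfect) (hΘ : Bijective (D.toTateDual lam hlam exp hexp))
    {ι : Type} [Finite ι] (r : ι → R) (hbij : Bijective fun x : R => fun i : ι => exp (lam (r i * x)))
    (S : Finset (Place K))
    (hS : ∀ v : HeightOneSpectrum (𝓞 K), (Sum.inr v : Place K) ∉ S →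
      ((p ^ k : ℕ) : 𝓞 K) ∉ v.asIdeal ∧ GaloisRep.IsUnramifiedAt v ρ)
    (𝓕 𝒯 : SelmerStructure ρ) (n : Finset (HeightOneSpectrum (𝓞 K))) {q : HeightOneSpectrum (𝓞 K)}
    (hq : cd.σ • q = q) (hqn : q ∉ n) (hqS : (Sum.inr q : Place K) ∈ S)
    (h𝓡S : (𝓕.modify 𝒯 {q} ∅ n).IsUnramifiedOutside S)
    (horth : ∀ v : HeightOneSpectrum (𝓞 K), v ≠ q → D.IsSelfOrthogonalAt (𝓕.modify 𝒯 ∅ ∅ n) v)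
    (hstab : ∀ v : HeightOneSpectrum (𝓞 K), v ≠ q → ∀ i, ∀ a ∈ 𝓕.modify 𝒯 ∅ ∅ n (Sum.inr v),
      galoisCohomology.scalarMapH1 (ρ.toLocal (Sum.inr v)) (isScalarLinear_toLocal hρ (Sum.inr v)) (r i) a ∈
        𝓕.modify 𝒯 ∅ ∅ n (Sum.inr v))
    (hinf : ∀ (w : InfinitePlace K) (c : galoisCohomology ρ 1),
      galoisCohomology.localization ρ (Sum.inl w) 1 c = 0)
    -- the local arithmetic at `q`
    (ℓ : ℕ) (jbar : AlgebraicClosure K →+* ℂ)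
    (h𝓕q : 𝓕 (Sum.inr q) = unramifiedSubgroup (GaloisRep.toLocal q ρ) 1)
    (h𝒯q : 𝒯 (Sum.inr q) = transverseCondition p ρ ℓ jbar q)
    (htriv : ∀ (g : absoluteGaloisGroup (q.adicCompletion K)) (x : M), GaloisRep.toLocal q ρ g x = x)
    (htriv' : ∀ (g : absoluteGaloisGroup ((cd.σ • q).adicCompletion K)) (x : M), GaloisRep.toLocal (cd.σ • q) ρ g x = x)
    (htrivTw : ∀ (g : absoluteGaloisGroup (q.adicCompletion K)) (x : M), GaloisRep.toLocal q (cd.twist ρ) g x = x)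
    (hp : ∀ x : M, ∃ m : ℕ, p ^ m • x = 0) {N : ℕ} (hN : Odd N) (hRN : ∀ r : R, N • r = 0)
    (hI : ∀ g ∈ absInertia (q.adicCompletion K), cd.φ q g ∈ absInertia ((cd.σ • q).adicCompletion K))
    (hφ : ∀ h ∈ localRingClassSubgroup ℓ jbar q, cd.φ q h ∈ localRingClassSubgroup ℓ jbar (cd.σ • q))
    (σ₀ : absoluteGaloisGroup (q.adicCompletion K))
    (hcyc : ∀ σ, ∃ j : ℕ, (σ₀ ^ j)⁻¹ * σ ∈ localRingClassSubgroup ℓ jbar q)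
    (hφI : ∀ g : absoluteGaloisGroup (q.adicCompletion K), ∃ i ∈ absInertia (q.adicCompletion K),
      (hq ▸ cd.φ q g : absoluteGaloisGroup (q.adicCompletion K)) = i * g)
    (hφΛ : ∀ g : absoluteGaloisGroup (q.adicCompletion K), ∃ l ∈ localRingClassSubgroup ℓ jbar q,
      (hq ▸ cd.φ q g : absoluteGaloisGroup (q.adicCompletion K)) = l * g⁻¹)
    (hδ : ∀ u w : M, D.e u (ρ (cd.δ q) w) = D.e w (ρ (cd.δ q) u)) :
    letI := galoisCohomology.moduleH1 ρ hρ𝒪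
    letI := galoisCohomology.moduleH1 (ρ.toLocal (Sum.inr q))
      (hρ𝒪.restrictField (Place.Completion (Sum.inr q)))
    ∀ (f : galoisCohomology ρ 1 →ₗ[𝒪] galoisCohomology (ρ.toLocal (Sum.inr q)) 1)
      (S₁ S₂ S𝓢 : Submodule 𝒪 (galoisCohomology ρ 1))
      (SA SVf SVtr : Submodule 𝒪 (galoisCohomology (ρ.toLocal (Sum.inr q)) 1)),
      (∀ c, f c = galoisCohomology.localization ρ (Sum.inr q) 1 c) →
      S₁.toAddSubgroup = (𝓕.modify 𝒯 ∅ ∅ n).selmerGroup →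
      S₂.toAddSubgroup = (𝓕.modify 𝒯 ∅ ∅ (insert q n)).selmerGroup →
      S𝓢.toAddSubgroup = (𝓕.modify 𝒯 ∅ {q} n).selmerGroup →
      SA.toAddSubgroup = (𝓕.modify 𝒯 {q} ∅ n).selmerGroup.map
        (galoisCohomology.localization ρ (Sum.inr q) 1) →
      SVf.toAddSubgroup = 𝓕 (Sum.inr q) → SVtr.toAddSubgroup = 𝒯 (Sum.inr q) →
      IsCompl SVf SVtr →
      ∀ {kk : ℕ}, Nonempty (↥SVf ≃ₗ[𝒪] (Fin 2 → 𝒪 ⧸ Ideal.span {ϖ ^ kk})) →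
        Nonempty (↥SVtr ≃ₗ[𝒪] (Fin 2 → 𝒪 ⧸ Ideal.span {ϖ ^ kk})) →
      ∀ {Q M₁ M₂ : Type} [AddCommGroup Q] [Module 𝒪 Q] [AddCommGroup M₁] [Module 𝒪 M₁]
        [AddCommGroup M₂] [Module 𝒪 M₂] (ε kQ lam₁ lam₂ : ℕ),
        Nonempty (↥S₁ ≃ₗ[𝒪] (Fin ε → Q) × (M₁ × M₁)) → Nonempty (↥S₂ ≃ₗ[𝒪] (Fin ε → Q) × (M₂ × M₂)) →
        Module.length 𝒪 Q = kQ → Module.length 𝒪 M₁ = lam₁ → Module.length 𝒪 M₂ = lam₂ →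
        ϖ ^ lam₁ • S₁ ≤ LinearMap.ker f → ϖ ^ lam₂ • S₂ ≤ LinearMap.ker f := by
  intro f S₁ S₂ S𝓢 SA SVf SVtr hf hS₁ hS₂ hS𝓢 hSA hSVf hSVtr hc kk hef hetr Q M₁ M₂ _ _ _ _ _ _ ε kQ lam₁ lam₂
    hθ₁ hθ₂ hQ hM₁ hM₂
  have hoff : ∀ v : HeightOneSpectrum (𝓞 K), v ≠ q →
      𝓕.modify 𝒯 {q} ∅ n (Sum.inr v) = 𝓕.modify 𝒯 ∅ ∅ n (Sum.inr v) := fun v hv =>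
    (SelmerStructure.modify_level_eq_relaxed_of_ne 𝓕 𝒯 q n (Sum.inr v) (fun h => hv (Sum.inr_injective h))).symm
  exact smul_le_ker_of_smul_le_ker_of_transfer 𝓕 𝒯 q n hqn hρ𝒪 ϖ f S₁ S₂ S𝓢 SA SVf SVtr hf hS₁ hS₂
    hS𝓢 hSA hSVf hSVtr ε kQ lam₁ lam₂ hθ₁ hθ₂ hQ hM₁ hM₂
    (D.forall_pow_smul_eq_zero_of_inert_local lam hlam exp hexp hϖ h2 hsoc hρ𝒪 hρ hn hRk hRp inv hPT hSC hperf hΘ r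
      hbij S hS (𝓕.modify 𝒯 ∅ ∅ n) (𝓕.modify 𝒯 {q} ∅ n) hq hqS h𝓡S
      (SelmerStructure.modify_relaxed_apply_self 𝓕 𝒯 q n) hoff horth hstab hinf ℓ jbar htriv htriv' htrivTw hp
      hN hRN hI hφ σ₀ hcyc hφI hφΛ hδ SA SVf SVtr hSA (hSVf.trans h𝓕q) (hSVtr.trans h𝒯q) hc hef hetr)

end DualityDatum

end Literature.NumberTheory.GaloisCohomology.Howard2004

end
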